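import Mathlib
import Summits.KontsevichZagierPeriods.Zeta5Search.RecordCellATwoPointPF
import Summits.KontsevichZagierPeriods.Zeta5Search.RecordCellAReflect
import Summits.KontsevichZagierPeriods.Zeta5Search.ClusterValuationPairs
import HarnessLib

/-!
# ζ(5) search — the leading digits of the class pieces `W_x`, `V_x` at a two-point class of type `(1,3)` and its conjugate

Cell `pub-zeta5` (HONEST FRAMING: systematic search; no irrationality claim unless certified), P1 prover seat
generation 5; part of the Lean proof of census g11's `RecordCellA`.  For `b` in the polytope, a window prime `p ≥ 5` and a
class `x = {q₀, q₀+p}` (`q₀ < p ≤ q₀ + p ≤ b₀ < q₀ + 2p`) with net exponents `(−1, −3)` (pole orders `1, 3`; class exponent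
`E_x = −4`), writing `g = gTop b p q₀ 0` for the (integral) constant term of the foreign factor and `x̄ = {b₀−q₀−p, b₀−q₀}` for
the conjugate class (type `(−3,−1)`, by the reflection `c_{o,b₀−q} = (−1)^o c_{o,q}`):

* `p·W_x = −g = p·W_x̄` EXACTLY (`W_x := Σ_{q ∈ x} c_{2,q}`, `classW`);
* `p⁴·V_x ≡ −3g`, `p⁴·V_x̄ ≡ g (mod p)` (`V_x = classV`, the harmonic sums at level 1 contribute `p^{−σ}` + integral);
* hence the PAIR CONGRUENCE `p·(W_x + W_x̄) ≡ p⁴·(V_x + V_x̄) (mod p)` (`digitA_pair`), the form in which the first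
  Casoratian digit cancels on the record cell.
`p`-adic norms of rational numbers; nothing about irrationality.
-/

noncomputable section

open Finset PowerSeries

namespace Summit.KontsevichZagierPeriods.Zeta5Search.CellA

open Summit.KontsevichZagierPeriods.Zeta5Search.DualSeries (InBox)
open Summit.KontsevichZagierPeriods.Zeta5Search.WedgeDictionary (IsPFData pfData coeffW)
open Summit.KontsevichZagierPeriods.Zeta5Search.CasoratianValuation (InPolytope)
open Summit.KontsevichZagierPeriods.Zeta5Search.ClusterValuation
open Summit.KontsevichZagierPeriods.Zeta5Search.PadicSeries
open Summit.KontsevichZagierPeriods.Zeta5Search.BigPrime (padicNorm_mul_le_one)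
open Literature.NumberTheory.Transcendental.BallRivoal (harm)

variable {p : ℕ} [hp : Fact p.Prime]

/-! ### The class pieces of the ζ(3)-coefficient -/

/-- The class-`x` piece of the ζ(3)-coefficient: `W_x := Σ_{q ∈ class x} c_{2,q}`. -/
def classW (b : ℕ → ℤ) (p x : ℕ) : ℚ := ∑ q ∈ classSet b p x, pfData b 2 q

omit hp in
/-- **`W = Σ_x W_x`** (regrouping by residue classes). -/
theorem coeffW_eq_sum_classW (b : ℕ → ℤ) {p : ℕ} (hp0 : 0 < p) : coeffW b = ∑ x ∈ range p, classW b p x := by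
  unfold classW
  rw [sum_classSet_eq b hp0, coeffW]

/-- The digit defect of a class: `p·W_x − p⁴·V_x`. -/
def digitDefect (b : ℕ → ℤ) (p x : ℕ) : ℚ := (p : ℚ) * classW b p x - (p : ℚ) ^ 4 * classV b p x

/-! ### Small `p`-adic bookkeeping -/

/-- Sums of `p`-integral numbers are `p`-integral. -/
theorem nI_add {a c : ℚ} (ha : padicNorm p a ≤ 1) (hc : padicNorm p c ≤ 1) : padicNorm p (a + c) ≤ 1 :=
  (padicNorm.nonarchimedean (p := p)).trans (max_le ha hc)

/-- Differences of `p`-integral numbers are `p`-integral. -/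
theorem nI_sub {a c : ℚ} (ha : padicNorm p a ≤ 1) (hc : padicNorm p c ≤ 1) : padicNorm p (a - c) ≤ 1 :=
  (padicNorm.sub (p := p)).trans (max_le ha hc)

/-- Naturals are `p`-integral. -/
theorem nI_nat (m : ℕ) : padicNorm p (m : ℚ) ≤ 1 := by simpa using padicNorm.of_nat (p := p) m

/-- `‖p·a‖ ≤ p⁻¹` for `p`-integral `a`. -/
theorem small_p_mul {a : ℚ} (ha : padicNorm p a ≤ 1) : padicNorm p ((p : ℚ) * a) ≤ (p : ℚ) ^ (-(1 : ℤ)) := by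
  rw [padicNorm.mul, padicNorm_p]
  calc (p : ℚ) ^ (-(1 : ℤ)) * padicNorm p a ≤ (p : ℚ) ^ (-(1 : ℤ)) * 1 :=
        mul_le_mul_of_nonneg_left ha (zpow_p_nonneg _)
    _ = _ := mul_one _

/-- `p⁻¹ ≤ 1`. -/
theorem p_inv_le_one : (p : ℚ) ^ (-(1 : ℤ)) ≤ 1 := zpow_le_one_of_nonpos₀ one_le_p (by norm_num)

/-- Small numbers are integral. -/
theorem nI_of_small {a : ℚ} (ha : padicNorm p a ≤ (p : ℚ) ^ (-(1 : ℤ))) : padicNorm p a ≤ 1 := ha.trans p_inv_le_one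

/-- Sums of small numbers are small. -/
theorem small_add {a c : ℚ} (ha : padicNorm p a ≤ (p : ℚ) ^ (-(1 : ℤ))) (hc : padicNorm p c ≤ (p : ℚ) ^ (-(1 : ℤ))) :
    padicNorm p (a + c) ≤ (p : ℚ) ^ (-(1 : ℤ)) :=
  (padicNorm.nonarchimedean (p := p)).trans (max_le ha hc)

/-- Differences of small numbers are small. -/
theorem small_sub {a c : ℚ} (ha : padicNorm p a ≤ (p : ℚ) ^ (-(1 : ℤ))) (hc : padicNorm p c ≤ (p : ℚ) ^ (-(1 : ℤ))) :
    padicNorm p (a - c) ≤ (p : ℚ) ^ (-(1 : ℤ)) :=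
  (padicNorm.sub (p := p)).trans (max_le ha hc)

/-- Integral times small is small. -/
theorem small_mul {a c : ℚ} (ha : padicNorm p a ≤ 1) (hc : padicNorm p c ≤ (p : ℚ) ^ (-(1 : ℤ))) :
    padicNorm p (a * c) ≤ (p : ℚ) ^ (-(1 : ℤ)) := by
  rw [padicNorm.mul]
  calc padicNorm p a * padicNorm p c ≤ 1 * (p : ℚ) ^ (-(1 : ℤ)) := mul_le_mul ha hc (padicNorm.nonneg _) zero_le_one
    _ = _ := one_mul _

/-- **The digit step**: if `A` is integral, `A ≡ a` and `E ≡ 1 (mod p)`, then `A·E ≡ a (mod p)`. -/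
theorem approx_mul {A E a : ℚ} (hA : padicNorm p A ≤ 1) (hE : padicNorm p (E - 1) ≤ (p : ℚ) ^ (-(1 : ℤ)))
    (hAa : padicNorm p (A - a) ≤ (p : ℚ) ^ (-(1 : ℤ))) : padicNorm p (A * E - a) ≤ (p : ℚ) ^ (-(1 : ℤ)) := by
  have e : A * E - a = A * (E - 1) + (A - a) := by ring
  rw [e]; exact small_add (small_mul hA hE) hAa

/-! ### A two-point class `{q₀, q₀+p}` at levels 0 and 1, and its conjugate -/

section TwoPoint

variable (b : ℕ → ℤ) (hb : InPolytope b) (hp5 : 5 ≤ p) (hwin : (b 0 + 2 : ℤ) < (p : ℤ) ^ 2) {q₀ : ℕ}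
  (hq₀ : q₀ < p) (hq₁ : q₀ + p ≤ (b 0).toNat) (htop : (b 0).toNat < q₀ + 2 * p)

include hq₀ hq₁ htop in
omit hp in
/-- The class of `q₀` is `{q₀, q₀ + p}`. -/
theorem classSet_twoPoint (hp0 : 0 < p) : classSet b p q₀ = {q₀, q₀ + p} := by
  ext s
  rw [mem_classSet_iff, mem_insert, mem_singleton]
  constructor
  · rintro ⟨hs, hdvd⟩
    by_contra hne
    push Not at hne
    exact far_of_twoPoint hp0 hq₀ htop s hs hne.1 hne.2 hdvd
  · rintro (rfl | rfl)
    · exact ⟨by omega, by simp⟩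
    · exact ⟨hq₁, by push_cast; simp⟩

include hq₀ hq₁ htop in
omit hp in
/-- The conjugate class `x̄ = b₀ − q₀ − p` is again a two-point class at levels 0 and 1: its data. -/
theorem conj_twoPoint_data :
    (b 0).toNat - (q₀ + p) < p ∧ (b 0).toNat - (q₀ + p) + p ≤ (b 0).toNat ∧
      (b 0).toNat < (b 0).toNat - (q₀ + p) + 2 * p ∧ (b 0).toNat - (q₀ + p) + p = (b 0).toNat - q₀ := by
  omega

include hb hq₁ in
omit hp in
/-- Reflected coefficients at the two points of the conjugate class. -/
theorem pfData_conj {o : ℕ} (ho : o < 6) :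
    pfData b o ((b 0).toNat - (q₀ + p)) = (-1 : ℚ) ^ o * pfData b o (q₀ + p) ∧
      pfData b o ((b 0).toNat - q₀) = (-1 : ℚ) ^ o * pfData b o q₀ :=
  ⟨pfData_reflect b hb hq₁ ho, pfData_reflect b hb (by omega) ho⟩

omit hp in
/-- A sum over `range 6` whose terms vanish from `o = 3` on. -/
theorem sum_range_six_of_ge_three {f : ℕ → ℚ} (h : ∀ o, 3 ≤ o → o < 6 → f o = 0) :
    ∑ o ∈ range 6, f o = f 0 + f 1 + f 2 := by
  simp only [sum_range_succ, sum_range_zero, zero_add, h 3 (by norm_num) (by norm_num), h 4 (by norm_num) (by norm_num),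
    h 5 (by norm_num) (by norm_num), add_zero]

omit hp in
/-- A sum over `range 6` whose terms vanish from `o = 1` on. -/
theorem sum_range_six_of_ge_one {f : ℕ → ℚ} (h : ∀ o, 1 ≤ o → o < 6 → f o = 0) : ∑ o ∈ range 6, f o = f 0 := by
  simp only [sum_range_succ, sum_range_zero, zero_add, h 1 (by norm_num) (by norm_num), h 2 (by norm_num) (by norm_num),
    h 3 (by norm_num) (by norm_num), h 4 (by norm_num) (by norm_num), h 5 (by norm_num) (by norm_num), add_zero]

/-! ### Type `(1,3)`: the class `x` itself -/

include hb hwin hq₀ hq₁ htop in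
/-- **`p·W_x = −g`** for a class of type `(1,3)`. -/
theorem classW_A (he₀ : netExp b q₀ = -1) (he₁ : netExp b (q₀ + p) = -3) :
    (p : ℚ) * classW b p q₀ = -gTop b p q₀ 0 := by
  have hp0 : (p : ℚ) ≠ 0 := Nat.cast_ne_zero.2 hp.out.ne_zero
  obtain ⟨c2, -, -, -⟩ := pfA_top b hb hwin hq₁ he₀ he₁
  obtain ⟨-, hz⟩ := pfA_bot b hb hwin hq₁ he₀ he₁
  rw [classW, classSet_twoPoint b hq₀ hq₁ htop hp.out.pos, sum_pair (by have := hp.out.pos; omega), c2,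
    hz 2 (by norm_num) (by norm_num), zero_add, mul_div_cancel₀ _ hp0]

include hb hp5 hwin hq₀ hq₁ htop in
/-- **`p⁴·V_x ≡ −3g (mod p)`** for a class of type `(1,3)`. -/
theorem classV_A (he₀ : netExp b q₀ = -1) (he₁ : netExp b (q₀ + p) = -3) :
    padicNorm p ((p : ℚ) ^ 4 * classV b p q₀ + 3 * gTop b p q₀ 0) ≤ (p : ℚ) ^ (-(1 : ℤ)) := by
  have hp0 : (p : ℚ) ≠ 0 := Nat.cast_ne_zero.2 hp.out.ne_zero
  have hp2 : p ≠ 2 := by have := hp5; omega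
  have hn : (b 0).toNat < p ^ 2 := (thmA_data b hb hwin).2.2.2
  obtain ⟨c2, c1, c0, hz⟩ := pfA_top b hb hwin hq₁ he₀ he₁
  obtain ⟨d0, hz'⟩ := pfA_bot b hb hwin hq₁ he₀ he₁
  set g := gTop b p q₀ 0 with hg
  set g₁ := gTop b p q₀ 1 with hg₁
  set g₂ := gTop b p q₀ 2 with hg₂
  set g' := gBot b p q₀ 0 with hg'
  have ig : padicNorm p g ≤ 1 := padicNorm_gTop_le b hq₀ hq₁ htop hn hp2 0
  have ig₁ : padicNorm p g₁ ≤ 1 := padicNorm_gTop_le b hq₀ hq₁ htop hn hp2 1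
  have ig₂ : padicNorm p g₂ ≤ 1 := padicNorm_gTop_le b hq₀ hq₁ htop hn hp2 2
  have ig' : padicNorm p g' ≤ 1 := padicNorm_gBot_le b hq₀ hq₁ htop hn hp2 0
  have ip : padicNorm p (p : ℚ) ≤ 1 := nI_nat p
  have ip2 : padicNorm p ((p : ℚ) ^ 2) ≤ 1 := by rw [sq]; exact padicNorm_mul_le_one ip ip
  -- level-1 harmonic sums
  have hH : ∀ {i : ℕ}, 1 ≤ i → padicNorm p ((p : ℚ) ^ i * harm i (q₀ + p) - 1) ≤ (p : ℚ) ^ (-(1 : ℤ)) :=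
    fun hi => padicNorm_pow_mul_harm_sub_one_le (by omega) (by omega) hi
  -- expand the class piece
  have hV : classV b p q₀ = pfData b 0 q₀ * harm 1 q₀ +
      (pfData b 0 (q₀ + p) * harm 1 (q₀ + p) + pfData b 1 (q₀ + p) * harm 2 (q₀ + p) +
        pfData b 2 (q₀ + p) * harm 3 (q₀ + p)) := by
    rw [classV, classSet_twoPoint b hq₀ hq₁ htop hp.out.pos, sum_pair (by have := hp.out.pos; omega),
      sum_range_six_of_ge_one (fun o h1 h6 => by rw [hz' o h1 h6, zero_mul]),
      sum_range_six_of_ge_three (fun o h3 h6 => by rw [hz o h3 h6, zero_mul])]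
  -- the four terms, each normalised
  have e : (p : ℚ) ^ 4 * classV b p q₀ + 3 * g =
      g' * ((p : ℚ) ^ 1 * harm 1 q₀) +
      (((-(p : ℚ) ^ 2 * g₂ - p * g₁ - g) * ((p : ℚ) ^ 1 * harm 1 (q₀ + p)) - (-g)) +
       ((-(p : ℚ) * g₁ - g) * ((p : ℚ) ^ 2 * harm 2 (q₀ + p)) - (-g)) +
       ((-g) * ((p : ℚ) ^ 3 * harm 3 (q₀ + p)) - (-g))) := by
    rw [hV, d0, c0, c1, c2]
    field_simp
    ring
  rw [e]
  refine small_add (small_mul ig' (padicNorm_pow_mul_harm_le hq₀ le_rfl)) (small_add (small_add ?_ ?_) ?_)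
  · refine approx_mul (nI_sub (nI_sub ?_ (padicNorm_mul_le_one ip ig₁)) ig) (hH le_rfl) ?_
    · rw [neg_mul]; exact (padicNorm.neg (p := p) _).le.trans (padicNorm_mul_le_one ip2 ig₂)
    · have e1 : -(p : ℚ) ^ 2 * g₂ - p * g₁ - g - -g = p * (-(p * g₂) - g₁) := by ring
      rw [e1]
      exact small_p_mul (nI_sub ((padicNorm.neg (p := p) _).le.trans (padicNorm_mul_le_one ip ig₂)) ig₁)
  · refine approx_mul (nI_sub ?_ ig) (hH (by norm_num)) ?_
    · rw [neg_mul]; exact (padicNorm.neg (p := p) _).le.trans (padicNorm_mul_le_one ip ig₁)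
    · have e1 : -(p : ℚ) * g₁ - g - -g = p * (-g₁) := by ring
      rw [e1]; exact small_p_mul ((padicNorm.neg (p := p) _).le.trans ig₁)
  · refine approx_mul ((padicNorm.neg (p := p) _).le.trans ig) (hH (by norm_num)) ?_
    rw [sub_self, padicNorm.zero]; exact zpow_p_nonneg _

/-! ### Type `(1,3)`: the conjugate class `x̄ = {b₀ − q₀ − p, b₀ − q₀}` -/

include hb hwin hq₀ hq₁ htop in
/-- **`p·W_x̄ = −g`** (reflection: `W_x̄ = W_x`). -/
theorem classW_Abar (he₀ : netExp b q₀ = -1) (he₁ : netExp b (q₀ + p) = -3) :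
    (p : ℚ) * classW b p ((b 0).toNat - (q₀ + p)) = -gTop b p q₀ 0 := by
  have hp0 : (p : ℚ) ≠ 0 := Nat.cast_ne_zero.2 hp.out.ne_zero
  obtain ⟨hr₀, hr₁, hrtop, hr⟩ := conj_twoPoint_data b hq₀ hq₁ htop
  obtain ⟨c2, -, -, -⟩ := pfA_top b hb hwin hq₁ he₀ he₁
  obtain ⟨-, hz⟩ := pfA_bot b hb hwin hq₁ he₀ he₁
  rw [classW, classSet_twoPoint b hr₀ hr₁ hrtop hp.out.pos, sum_pair (by have := hp.out.pos; omega), hr,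
    (pfData_conj b hb hq₁ (by norm_num : 2 < 6)).1, (pfData_conj b hb hq₁ (by norm_num : 2 < 6)).2, c2,
    hz 2 (by norm_num) (by norm_num)]
  field_simp
  ring

include hb hp5 hwin hq₀ hq₁ htop in
/-- **`p⁴·V_x̄ ≡ g (mod p)`** for the conjugate of a class of type `(1,3)`. -/
theorem classV_Abar (he₀ : netExp b q₀ = -1) (he₁ : netExp b (q₀ + p) = -3) :
    padicNorm p ((p : ℚ) ^ 4 * classV b p ((b 0).toNat - (q₀ + p)) - gTop b p q₀ 0) ≤ (p : ℚ) ^ (-(1 : ℤ)) := by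
  have hp0 : (p : ℚ) ≠ 0 := Nat.cast_ne_zero.2 hp.out.ne_zero
  have hp2 : p ≠ 2 := by have := hp5; omega
  have hn : (b 0).toNat < p ^ 2 := (thmA_data b hb hwin).2.2.2
  obtain ⟨hr₀, hr₁, hrtop, hr⟩ := conj_twoPoint_data b hq₀ hq₁ htop
  obtain ⟨c2, c1, c0, hz⟩ := pfA_top b hb hwin hq₁ he₀ he₁
  obtain ⟨d0, hz'⟩ := pfA_bot b hb hwin hq₁ he₀ he₁
  set r₀ := (b 0).toNat - (q₀ + p) with hr₀def
  set g := gTop b p q₀ 0 with hg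
  set g₁ := gTop b p q₀ 1 with hg₁
  set g₂ := gTop b p q₀ 2 with hg₂
  set g' := gBot b p q₀ 0 with hg'
  have ig : padicNorm p g ≤ 1 := padicNorm_gTop_le b hq₀ hq₁ htop hn hp2 0
  have ig₁ : padicNorm p g₁ ≤ 1 := padicNorm_gTop_le b hq₀ hq₁ htop hn hp2 1
  have ig₂ : padicNorm p g₂ ≤ 1 := padicNorm_gTop_le b hq₀ hq₁ htop hn hp2 2
  have ig' : padicNorm p g' ≤ 1 := padicNorm_gBot_le b hq₀ hq₁ htop hn hp2 0
  have ip : padicNorm p (p : ℚ) ≤ 1 := nI_nat p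
  have ip2 : padicNorm p ((p : ℚ) ^ 2) ≤ 1 := by rw [sq]; exact padicNorm_mul_le_one ip ip
  have hgg : padicNorm p (g' - g) ≤ (p : ℚ) ^ (-(1 : ℤ)) := by
    rw [← padicNorm.neg, neg_sub]; exact padicNorm_gTop_sub_gBot_le b hq₀ hq₁ htop hn
  -- reflected coefficients
  have hc : ∀ o, o < 6 → pfData b o r₀ = (-1 : ℚ) ^ o * pfData b o (q₀ + p) := fun o ho => (pfData_conj b hb hq₁ ho).1
  have hc' : ∀ o, o < 6 → pfData b o (r₀ + p) = (-1 : ℚ) ^ o * pfData b o q₀ := fun o ho => by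
    rw [hr]; exact (pfData_conj b hb hq₁ ho).2
  -- expand the class piece
  have hV : classV b p r₀ =
      (pfData b 0 (q₀ + p) * harm 1 r₀ - pfData b 1 (q₀ + p) * harm 2 r₀ + pfData b 2 (q₀ + p) * harm 3 r₀) +
        pfData b 0 q₀ * harm 1 (r₀ + p) := by
    rw [classV, classSet_twoPoint b hr₀ hr₁ hrtop hp.out.pos, sum_pair (by have := hp.out.pos; omega),
      sum_range_six_of_ge_three (fun o h3 h6 => by rw [hc o h6, hz o h3 h6, mul_zero, zero_mul]),
      sum_range_six_of_ge_one (fun o h1 h6 => by rw [hc' o h6, hz' o h1 h6, mul_zero, zero_mul]),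
      hc 0 (by norm_num), hc 1 (by norm_num), hc 2 (by norm_num), hc' 0 (by norm_num)]
    ring
  have e : (p : ℚ) ^ 4 * classV b p r₀ - g =
      ((-(p : ℚ) ^ 2 * g₂ - p * g₁ - g) * ((p : ℚ) ^ 1 * harm 1 r₀) -
        (-(p : ℚ) * g₁ - g) * ((p : ℚ) ^ 2 * harm 2 r₀) + (-g) * ((p : ℚ) ^ 3 * harm 3 r₀)) +
      (g' * ((p : ℚ) ^ 1 * harm 1 (r₀ + p)) - g) := by
    rw [hV, d0, c0, c1, c2]
    field_simp
    ring
  rw [e]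
  have iA0 : padicNorm p (-(p : ℚ) ^ 2 * g₂ - p * g₁ - g) ≤ 1 := by
    refine nI_sub (nI_sub ?_ (padicNorm_mul_le_one ip ig₁)) ig
    rw [neg_mul]; exact (padicNorm.neg (p := p) _).le.trans (padicNorm_mul_le_one ip2 ig₂)
  have iA1 : padicNorm p (-(p : ℚ) * g₁ - g) ≤ 1 := by
    refine nI_sub ?_ ig
    rw [neg_mul]; exact (padicNorm.neg (p := p) _).le.trans (padicNorm_mul_le_one ip ig₁)
  refine small_add (small_add (small_sub (small_mul iA0 (padicNorm_pow_mul_harm_le hr₀ le_rfl))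
    (small_mul iA1 (padicNorm_pow_mul_harm_le hr₀ (by norm_num))))
    (small_mul ((padicNorm.neg (p := p) _).le.trans ig) (padicNorm_pow_mul_harm_le hr₀ (by norm_num)))) ?_
  exact approx_mul ig' (padicNorm_pow_mul_harm_sub_one_le (by omega) (by omega) le_rfl) hgg

/-! ### Type `(1,3)`: integrality of the digits and the pair congruence -/

include hb hp5 hwin hq₀ hq₁ htop in
/-- **TYPE `(1,3)` DIGIT PACKAGE**: `p·W` and `p⁴·V` are `p`-integral on the class and on its conjugate, and the pair
congruence `p·(W_x + W_x̄) ≡ p⁴·(V_x + V_x̄) (mod p)` holds (both sides `≡ −2g`). -/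
theorem digitA_pair (he₀ : netExp b q₀ = -1) (he₁ : netExp b (q₀ + p) = -3) :
    padicNorm p ((p : ℚ) * classW b p q₀) ≤ 1 ∧ padicNorm p ((p : ℚ) ^ 4 * classV b p q₀) ≤ 1 ∧
    padicNorm p ((p : ℚ) * classW b p ((b 0).toNat - (q₀ + p))) ≤ 1 ∧
    padicNorm p ((p : ℚ) ^ 4 * classV b p ((b 0).toNat - (q₀ + p))) ≤ 1 ∧
    padicNorm p (digitDefect b p q₀ + digitDefect b p ((b 0).toNat - (q₀ + p))) ≤ (p : ℚ) ^ (-(1 : ℤ)) := by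
  have hp2 : p ≠ 2 := by have := hp5; omega
  have hn : (b 0).toNat < p ^ 2 := (thmA_data b hb hwin).2.2.2
  have ig : padicNorm p (gTop b p q₀ 0) ≤ 1 := padicNorm_gTop_le b hq₀ hq₁ htop hn hp2 0
  have hW := classW_A b hb hwin hq₀ hq₁ htop he₀ he₁
  have hW' := classW_Abar b hb hwin hq₀ hq₁ htop he₀ he₁
  have hV := classV_A b hb hp5 hwin hq₀ hq₁ htop he₀ he₁
  have hV' := classV_Abar b hb hp5 hwin hq₀ hq₁ htop he₀ he₁
  have i3 : padicNorm p (3 : ℚ) ≤ 1 := by simpa using padicNorm.of_nat (p := p) 3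
  have i3g : padicNorm p (3 * gTop b p q₀ 0) ≤ 1 := padicNorm_mul_le_one i3 ig
  refine ⟨?_, ?_, ?_, ?_, ?_⟩
  · rw [hW, padicNorm.neg]; exact ig
  · have e : (p : ℚ) ^ 4 * classV b p q₀ = ((p : ℚ) ^ 4 * classV b p q₀ + 3 * gTop b p q₀ 0) - 3 * gTop b p q₀ 0 := by
      ring
    rw [e]; exact nI_sub (nI_of_small hV) i3g
  · rw [hW', padicNorm.neg]; exact ig
  · have e : (p : ℚ) ^ 4 * classV b p ((b 0).toNat - (q₀ + p)) =
        ((p : ℚ) ^ 4 * classV b p ((b 0).toNat - (q₀ + p)) - gTop b p q₀ 0) + gTop b p q₀ 0 := by ring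
    rw [e]; exact nI_add (nI_of_small hV') ig
  · have e : digitDefect b p q₀ + digitDefect b p ((b 0).toNat - (q₀ + p)) =
        -(((p : ℚ) ^ 4 * classV b p q₀ + 3 * gTop b p q₀ 0)) -
          (((p : ℚ) ^ 4 * classV b p ((b 0).toNat - (q₀ + p)) - gTop b p q₀ 0)) := by
      unfold digitDefect; rw [hW, hW']; ring
    rw [e]
    exact small_sub ((padicNorm.neg (p := p) _).le.trans hV) hV'

end TwoPoint

end Summit.KontsevichZagierPeriods.Zeta5Search.CellA

end
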